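import Summits.QuantumFields.BalabanUV.Beta.GAN24.WSlotCauchyOfShapes
import Summits.QuantumFields.BalabanUV.Beta.GAN24.WSlotSupRate
import Summits.QuantumFields.BalabanUV.Beta.GAN24.KSlotAssembly

/-!
# `BalabanUV.Beta.GAN24.WSlotCauchyThree` — binder row G-an2-4 / (CONV-C), `d = 3`, `Lc ≥ 2`: BOTH SECOND-ORDER ROWS OF THE WALL
# (`hW₂`, `hW₂all` with their scalars) for an2's family `BalabanStepW2.WbalOf` ⇐ «T2Shape» ∧ «T2Drift» ∧ (the mixed binder table's shape)
# ALONE — the K-slot (`KSlotAssembly.convCKWall_holds`) and «E3Shape» ∧ «E3Drift» (`SpureUnitDrift.e3ShapeDrift_three`, road S3) BY NAME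

NOT IN PRINT; OUR PROOF ATTEMPT (G-an2-4 formalisation swarm, idle leaf seat `b2b-balaban-gan24-formalise-leaf-07`, gen 11; module name
PROVISIONAL — the row owner gan24-p1 / the (P4) author an2 may rename or re-home it).  HONEST FRAMING (cell contract, verbatim): «discharging
`BetaPertH` makes Bałaban's UV stability UNCONDITIONAL — a real constructive-QFT result; it is NOT the continuum limit and NOT the Clay problem.»
HONEST DEPENDENCY (verbatim): «continuum YM on T⁴ ⇐ BetaPertH ∧ nine spine estimates (0/9 proved); BetaPertH ⇐ (D1) ∧ (D4) ∧ CAP+tail;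
G-an2-4 gates asym, D1 and NE2/3/4.»  [folklore] composition, every input BY NAME: road P1's K-slot `KSlotAssembly.convCKWall_holds` (p204341)
= `UnitDecayK ∧ CauchyDecayK` in the adopted units; road S3's located third-jet shapes «E3Shape» ∧ «E3Drift» at `d = 3` as packaged by leaf-10's
`SpureUnitDrift.e3ShapeDrift_three` (p209678; the twelve S3 rows inside); the generic W-slot plugs `WSlotOfShapes.hW_of_shapes` (p209355) and
`WSlotCauchyOfShapes.hW_hWall_of_shapes`.  No estimate, no cited fact, no `def`, no `Prop` mirror.
NOTHING of the wall is discharged unconditionally: the two W-rows are concluded FROM «T2Shape» ∧ «T2Drift» — the `j`-uniform `LocStencil₂`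
locality and the geometric all-scales drift of the NORMALISED bi-stencil binder tables `unitS₂ (sfStep Lc j) (smStep 3 Lc j) (T₂ j)` (for an2's
Stage-B `T2Of`: the recursive value 4-jet `e4OfW` + an3's `wilsonW₂` + an1's `vh₂S` border, leaf-19's `T2SlotUnits`; NOT IN PRINT, OPEN, asserted
nowhere; leaf-14-g21's / leaf-18-g15's remarks l.6956 / l.7190: not an induction in `j` — marginal at `d = 3`) — and FROM the mixed binder table's
own `LocStencilFM` shape with field–field support (an1's `mixFFAt`: ff-valued by definition).  With these two rows, `2 ≤ Lc` and the scalars,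
the owner's `StencilSlotWallThree.d1Drift_JsBalOf_iff_three_of_wRows` (p209916) turns the D1 WALL for `JsBalOf … (WbalOf …) …` into the
identification — that one-line composition is the ROW OWNER's to file.  NEVER «W-slot closed», NEVER «G-an2-4 closed».  NOT summit progress.

## What is proved (`d = 3`, `Lc ≥ 2`)
* `convCKWall_rows_three` — the K-slot's two rows in the adopted units with their scalars, unpacked from `ConvCKWall 3 Lc` (bookkeeping).
* **`hWall_three_of_T2ShapeDrift`** — «T2Shape» → «T2Drift» → mixFF-shape → `∃ cW θW δW, 0 ≤ θW ∧ θW < 1 ∧ 0 < δW ∧ ∀ k j, VertexFamily₂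
  (unitW_{k+j} (WbalOf 3 Lc cE cVH cΛ T₂ mixFF (k+j)) − unitW_k (WbalOf … k)) Lc (cW·θW^k) δW`.
* **`hW_hWall_three_of_T2ShapeDrift`** — the PAIR `(hW₂, hW₂all)` of `StencilSlotWallThree.d1Drift_JsBalOf_iff_three_of_wRows` with
  `(hδW, hθW0, hθW1)`, ONE common rate, for `W := WbalOf 3 Lc cE cVH cΛ T₂ mixFF`.
* **`hW_hWall_three_of_T2ShapeSupRate`** — the same pair from «T2Shape» ∧ «T2SupRate» (a plain ONE-STEP SUP-NORM rate of the normalised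
  bi-stencil tables, the currency of the owner's SKELETON-W3 §0 / RULINGS-12), «T2Drift» derived inside by leaf-01's
  `WSlotSupRate.locStencil₂Cauchy_of_uniform_supRate` (ratio `√θ`, rate `δ₂/2`).
-/

noncomputable section

open Literature.MathematicalPhysics.QuantumFieldTheory
open Literature.MathematicalPhysics.QuantumFieldTheory.Balaban1983to89
open Literature.MathematicalPhysics.QuantumFieldTheory.Balaban1983to89.Beta
open ExpKernelCalculus (MKer VertexFamily₂)
open OneStepResolventKernel (Fib)
open BalabanCompositeJets (LocStencil₂)
open SecondOrderResponse (LocStencilFM)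
open BalabanStepW2 (WbalOf)
open Summit.QuantumFields.BalabanUV.Beta.HessKerDressedUnits (unitW)
open Summit.QuantumFields.BalabanUV.Beta.SecondOrderUnits (unitS₂)
open Summit.QuantumFields.BalabanUV.Beta.GAN24.CombesThomas (sfStep smStep UnitDecayK CauchyDecayK SupBound)
open Summit.QuantumFields.BalabanUV.Beta.GAN24.StencilSlotOfE3 (one_le_of_two_le)
open Summit.QuantumFields.BalabanUV.Beta.GAN24.KSlotAssembly (convCKWall_holds)
open Summit.QuantumFields.BalabanUV.Beta.GAN24.SpureUnitDrift (e3ShapeDrift_three)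
open Summit.QuantumFields.BalabanUV.Beta.GAN24.WSlotCauchyOfShapes (hWall_of_shapes hW_hWall_of_shapes)
open Summit.QuantumFields.BalabanUV.Beta.GAN24.WSlotSupRate (locStencil₂Cauchy_of_uniform_supRate)

namespace Summit.QuantumFields.BalabanUV.Beta.GAN24.WSlotCauchyThree

variable {Lc : ℕ} [NeZero Lc]

/-- [folklore] The K-slot's TWO ROWS in the adopted units at `d = 3`, `Lc ≥ 2`, with their scalars, unpacked from road P1's `ConvCKWall 3 Lc`
(`KSlotAssembly.convCKWall_holds`): `∃ C δ cK θ, 0 < δ ∧ 0 ≤ θ ∧ θ < 1 ∧ UnitDecayK … C δ ∧ CauchyDecayK … cK θ δ`. -/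
theorem convCKWall_rows_three (hLc : 2 ≤ Lc) : ∃ C δ cK θ : ℝ, 0 < δ ∧ 0 ≤ θ ∧ θ < 1 ∧
    UnitDecayK 3 Lc (sfStep Lc) (smStep 3 Lc) C δ ∧ CauchyDecayK 3 Lc (sfStep Lc) (smStep 3 Lc) cK θ δ :=
  convCKWall_holds (Lc := Lc) hLc

/-- **THE WALL's CAUCHY W-ROW `hWall` AT `d = 3`, `Lc ≥ 2`, FROM «T2Shape» ∧ «T2Drift» AND THE MIXED-TABLE SHAPE ALONE** [folklore
composition]: K-slot by `KSlotAssembly.convCKWall_holds`, «E3Shape» ∧ «E3Drift» by `SpureUnitDrift.e3ShapeDrift_three`, into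
`WSlotCauchyOfShapes.hWall_of_shapes`. -/
theorem hWall_three_of_T2ShapeDrift (hLc : 2 ≤ Lc) (cE cVH cΛ : ℝ)
    {T₂ : ℕ → Fin (3 + 1) → (Fin (3 + 1) → ℤ) → Fin (3 + 1) → (Fin (3 + 1) → ℤ) → MKer (3 + 1) (Fib 3)} {C₂ c₂ θ₂ δ₂ : ℝ}
    (hT₂ : ∀ j, LocStencil₂ (unitS₂ (sfStep Lc j) (smStep 3 Lc j) (T₂ j)) C₂ δ₂)
    (hT₂d : ∀ k j, LocStencil₂ (unitS₂ (sfStep Lc (k + j)) (smStep 3 Lc (k + j)) (T₂ (k + j)) -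
      unitS₂ (sfStep Lc k) (smStep 3 Lc k) (T₂ k)) (c₂ * θ₂ ^ k) δ₂)
    (hδ₂ : 0 < δ₂) (hθ₂0 : 0 ≤ θ₂) (hθ₂1 : θ₂ < 1)
    {mixFF : Fin (3 + 1) → (Fin (3 + 1) → ℤ) → Fin (3 + 1) → (Fin (3 + 1) → ℤ) → MKer (3 + 1) (Fib 3)} {CM₂ δ₄ : ℝ}
    (hmix : LocStencilFM Lc mixFF CM₂ δ₄) (hδ₄ : 0 < δ₄)
    (hfm : ∀ κ u ρ w x z (α μ' : Fin (3 + 1)), mixFF κ u ρ w x z (Sum.inl α) (Sum.inr μ') = 0)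
    (hm : ∀ κ u ρ w x z (μ' : Fin (3 + 1)) (b : Fib 3), mixFF κ u ρ w x z (Sum.inr μ') b = 0) :
    ∃ cW θW δW : ℝ, 0 ≤ θW ∧ θW < 1 ∧ 0 < δW ∧
      ∀ k j, VertexFamily₂ (unitW (sfStep Lc (k + j)) (smStep 3 Lc (k + j)) (WbalOf 3 Lc cE cVH cΛ T₂ mixFF (k + j)) -
        unitW (sfStep Lc k) (smStep 3 Lc k) (WbalOf 3 Lc cE cVH cΛ T₂ mixFF k)) Lc (cW * θW ^ k) δW := by
  obtain ⟨C, δ, cK, θ, hδ, hθ0, hθ1, hK, hKall⟩ := convCKWall_holds (Lc := Lc) hLc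
  obtain ⟨C₃, c₃, θ₃, δ₃, hθ₃, hθ₃1, hδ₃, hE3, hE3d⟩ := e3ShapeDrift_three (Lc := Lc) hLc cE cVH cΛ
  exact hWall_of_shapes (one_le_of_two_le hLc) hK hKall hδ hθ0 hθ1 hE3 hE3d hθ₃ hθ₃1 hδ₃ hT₂ hT₂d hδ₂ hθ₂0 hθ₂1 hmix hδ₄ hfm hm

/-- **BOTH W-ROWS OF THE D1-WALL COUNTDOWN FOR an2's FAMILY AT `d = 3`, `Lc ≥ 2`, FROM «T2Shape» ∧ «T2Drift» AND THE MIXED-TABLE SHAPE ALONE**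
[folklore composition]: the pair `(hW₂, hW₂all)` of `StencilSlotWallThree.d1Drift_JsBalOf_iff_three_of_wRows` together with `(hδW, hθW0, hθW1)`,
for `W := WbalOf 3 Lc cE cVH cΛ T₂ mixFF`, at ONE common decay rate. -/
theorem hW_hWall_three_of_T2ShapeDrift (hLc : 2 ≤ Lc) (cE cVH cΛ : ℝ)
    {T₂ : ℕ → Fin (3 + 1) → (Fin (3 + 1) → ℤ) → Fin (3 + 1) → (Fin (3 + 1) → ℤ) → MKer (3 + 1) (Fib 3)} {C₂ c₂ θ₂ δ₂ : ℝ}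
    (hT₂ : ∀ j, LocStencil₂ (unitS₂ (sfStep Lc j) (smStep 3 Lc j) (T₂ j)) C₂ δ₂)
    (hT₂d : ∀ k j, LocStencil₂ (unitS₂ (sfStep Lc (k + j)) (smStep 3 Lc (k + j)) (T₂ (k + j)) -
      unitS₂ (sfStep Lc k) (smStep 3 Lc k) (T₂ k)) (c₂ * θ₂ ^ k) δ₂)
    (hδ₂ : 0 < δ₂) (hθ₂0 : 0 ≤ θ₂) (hθ₂1 : θ₂ < 1)
    {mixFF : Fin (3 + 1) → (Fin (3 + 1) → ℤ) → Fin (3 + 1) → (Fin (3 + 1) → ℤ) → MKer (3 + 1) (Fib 3)} {CM₂ δ₄ : ℝ}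
    (hmix : LocStencilFM Lc mixFF CM₂ δ₄) (hδ₄ : 0 < δ₄)
    (hfm : ∀ κ u ρ w x z (α μ' : Fin (3 + 1)), mixFF κ u ρ w x z (Sum.inl α) (Sum.inr μ') = 0)
    (hm : ∀ κ u ρ w x z (μ' : Fin (3 + 1)) (b : Fib 3), mixFF κ u ρ w x z (Sum.inr μ') b = 0) :
    ∃ Cw cW θW δW : ℝ, 0 ≤ θW ∧ θW < 1 ∧ 0 < δW ∧
      (∀ j, VertexFamily₂ (unitW (sfStep Lc j) (smStep 3 Lc j) (WbalOf 3 Lc cE cVH cΛ T₂ mixFF j)) Lc Cw δW) ∧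
      (∀ k j, VertexFamily₂ (unitW (sfStep Lc (k + j)) (smStep 3 Lc (k + j)) (WbalOf 3 Lc cE cVH cΛ T₂ mixFF (k + j)) -
        unitW (sfStep Lc k) (smStep 3 Lc k) (WbalOf 3 Lc cE cVH cΛ T₂ mixFF k)) Lc (cW * θW ^ k) δW) := by
  obtain ⟨C, δ, cK, θ, hδ, hθ0, hθ1, hK, hKall⟩ := convCKWall_holds (Lc := Lc) hLc
  obtain ⟨C₃, c₃, θ₃, δ₃, hθ₃, hθ₃1, hδ₃, hE3, hE3d⟩ := e3ShapeDrift_three (Lc := Lc) hLc cE cVH cΛ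
  exact hW_hWall_of_shapes (one_le_of_two_le hLc) hK hKall hδ hθ0 hθ1 hE3 hE3d hθ₃ hθ₃1 hδ₃ hT₂ hT₂d hδ₂ hθ₂0 hθ₂1 hmix hδ₄ hfm hm

/-- **BOTH W-ROWS AT `d = 3`, `Lc ≥ 2`, FROM «T2Shape» ∧ «T2SupRate» AND THE MIXED-TABLE SHAPE ALONE** [folklore composition]: the drift
hypothesis of `hW_hWall_three_of_T2ShapeDrift` replaced by a plain ONE-STEP SUP-NORM RATE of the normalised bi-stencil tables (`0 ≤ c`,
`0 ≤ θ < 1`; no decay asked of the differences) — «T2Drift» is then leaf-01's `WSlotSupRate.locStencil₂Cauchy_of_uniform_supRate` (ratio `√θ`,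
rate `δ₂/2`).  This is the socket the owner's SKELETON-W3 ENDs («T2Shape» ∧ «T2SupRate», RULINGS-12) serve. -/
theorem hW_hWall_three_of_T2ShapeSupRate (hLc : 2 ≤ Lc) (cE cVH cΛ : ℝ)
    {T₂ : ℕ → Fin (3 + 1) → (Fin (3 + 1) → ℤ) → Fin (3 + 1) → (Fin (3 + 1) → ℤ) → MKer (3 + 1) (Fib 3)} {C₂ δ₂ c θ : ℝ}
    (hT₂ : ∀ j, LocStencil₂ (unitS₂ (sfStep Lc j) (smStep 3 Lc j) (T₂ j)) C₂ δ₂) (hδ₂ : 0 < δ₂)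
    (hR : ∀ (n : ℕ) (κ : Fin (3 + 1)) (u : Fin (3 + 1) → ℤ) (κ' : Fin (3 + 1)) (u' : Fin (3 + 1) → ℤ),
      SupBound (unitS₂ (sfStep Lc (n + 1)) (smStep 3 Lc (n + 1)) (T₂ (n + 1)) κ u κ' u' - unitS₂ (sfStep Lc n) (smStep 3 Lc n) (T₂ n) κ u κ' u')
        (c * θ ^ n))
    (hc : 0 ≤ c) (hθ0 : 0 ≤ θ) (hθ1 : θ < 1)
    {mixFF : Fin (3 + 1) → (Fin (3 + 1) → ℤ) → Fin (3 + 1) → (Fin (3 + 1) → ℤ) → MKer (3 + 1) (Fib 3)} {CM₂ δ₄ : ℝ}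
    (hmix : LocStencilFM Lc mixFF CM₂ δ₄) (hδ₄ : 0 < δ₄)
    (hfm : ∀ κ u ρ w x z (α μ' : Fin (3 + 1)), mixFF κ u ρ w x z (Sum.inl α) (Sum.inr μ') = 0)
    (hm : ∀ κ u ρ w x z (μ' : Fin (3 + 1)) (b : Fib 3), mixFF κ u ρ w x z (Sum.inr μ') b = 0) :
    ∃ Cw cW θW δW : ℝ, 0 ≤ θW ∧ θW < 1 ∧ 0 < δW ∧
      (∀ j, VertexFamily₂ (unitW (sfStep Lc j) (smStep 3 Lc j) (WbalOf 3 Lc cE cVH cΛ T₂ mixFF j)) Lc Cw δW) ∧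
      (∀ k j, VertexFamily₂ (unitW (sfStep Lc (k + j)) (smStep 3 Lc (k + j)) (WbalOf 3 Lc cE cVH cΛ T₂ mixFF (k + j)) -
        unitW (sfStep Lc k) (smStep 3 Lc k) (WbalOf 3 Lc cE cVH cΛ T₂ mixFF k)) Lc (cW * θW ^ k) δW) := by
  -- «T2Drift» from «T2Shape» ∧ «T2SupRate» (leaf-01's interpolation), ratio `√θ`, rate `δ₂/2`
  have hT₂' : ∀ j, LocStencil₂ (unitS₂ (sfStep Lc j) (smStep 3 Lc j) (T₂ j)) C₂ (δ₂ / 2) :=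
    fun j => (hT₂ j).mono (by linarith)
  have hT₂d : ∀ k j, LocStencil₂ (unitS₂ (sfStep Lc (k + j)) (smStep 3 Lc (k + j)) (T₂ (k + j)) -
      unitS₂ (sfStep Lc k) (smStep 3 Lc k) (T₂ k)) (Real.sqrt (2 * (c / (1 - θ)) * C₂) * Real.sqrt θ ^ k) (δ₂ / 2) :=
    fun k j => locStencil₂Cauchy_of_uniform_supRate (T := fun j => unitS₂ (sfStep Lc j) (smStep 3 Lc j) (T₂ j)) hT₂ hR hc hθ0 hθ1 k j
  have hs0 : 0 ≤ Real.sqrt θ := Real.sqrt_nonneg θ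
  have hs1 : Real.sqrt θ < 1 := by
    rw [show (1 : ℝ) = Real.sqrt 1 by rw [Real.sqrt_one]]
    exact Real.sqrt_lt_sqrt hθ0 hθ1
  exact hW_hWall_three_of_T2ShapeDrift hLc cE cVH cΛ hT₂' hT₂d (by positivity) hs0 hs1 hmix hδ₄ hfm hm

end Summit.QuantumFields.BalabanUV.Beta.GAN24.WSlotCauchyThree

end
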